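import Literature.Probability.RandomPlanarGeometry.LoewnerThrClock
import Literature.Probability.RandomPlanarGeometry.LoewnerImageStoppedClass
import HarnessLib

/-!
# Through-swallow dictionary: stopped classes and first hits of the conformal image

Topic `Probability/RandomPlanarGeometry`; theorems only (crux `stmt-CriticalPhenomena-0698`, stub
`stub_isLocal`, through-swallow image chain of the locality of SLE₆; Lawler–Schramm–Werner (2003) §5,
Lawler (2005) §6.3). The clock-API plumbing of `LoewnerImageStoppedClass.lean` /
`SLESixHullLocalityAlive.lean` (alive case) transposed to the through-swallow clock `thrClockC`
(`LoewnerRemainingHull.lean`, `LoewnerThrClock.lean`), with the TIP IDENTITY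
`γ̂ (σ u) = E_A (γ u)` (`u ≤ β₂`; the through-swallow chain identification, stub
`stub_thrTipIdentity`) and `γ u ∉ A` (`u ≤ β`) taken as hypotheses:

* `Loewner.thr_stoppedPathClass_starMap_eq_stopClass` — the class of `E_A ∘ γ` stopped at `T ≤ β₂`
  is the class of the image curve stopped at `σ T` (two monotone traversals of one arc);
* `Loewner.thr_firstHit_imageTrace_eq` — if `z ∈ S' ↔ E_A z ∈ S` off `A` and `γ` first hits `S'`
  at `t ≤ β₂`, the image curve first hits `S` at `σ t`.
-/

noncomputable section

open Set Filter Topology Function Complex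
open scoped NNReal unitInterval

namespace Literature.Probability.RandomPlanarGeometry

namespace Loewner

variable {W U' : ℝ≥0 → ℝ} {A : Set ℂ}

section Thr

variable (hA : IsStarHull A) {β β₂ : ℝ≥0} (hβ₂ : β₂ ≤ β)
  (hint : MeasureTheory.IntegrableOn (thrClockRate W A) (Icc (0 : ℝ) β))
  {γ γ' : ℝ≥0 → ℂ} (hγ : IsGeneratedByCurve W γ) (hnotA : ∀ u, u ≤ β → γ u ∉ A)
  (htip : ∀ u, u ≤ β₂ → γ' (thrClockC W A u) = starMap A (γ u))
include hA hβ₂ hint hγ hnotA htip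

omit hβ₂ hint htip in
/-- Along the generating curve, `s ↦ E_A (γ (T s))` is continuous for `T ≤ β` (the curve stays off
`A` in the closed half-plane, where `E_A` is continuous). [folklore] -/
theorem thr_continuous_starMap_stoppedPath {T : ℝ≥0} (hT : T ≤ β) :
    Continuous fun s : I ↦ starMap A (γ (((T : ℝ) * s).toNNReal)) := by
  have hpath : Continuous fun s : I ↦ γ (((T : ℝ) * s).toNNReal) :=
    hγ.continuous.comp (continuous_real_toNNReal.comp (continuous_const.mul continuous_subtype_val))
  refine (continuousOn_starMap hA).comp_continuous hpath fun s ↦ ⟨hγ.im_nonneg _, hnotA _ ?_⟩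
  rw [← NNReal.coe_le_coe, Real.coe_toNNReal _ (mul_nonneg T.coe_nonneg s.2.1)]
  exact (mul_le_of_le_one_right T.coe_nonneg s.2.2).trans (NNReal.coe_le_coe.2 hT)

omit hβ₂ hint htip in
/-- `r ↦ E_A (γ r⁺)` is continuous on `[0, T]` for `T ≤ β`. [folklore] -/
theorem thr_continuousOn_starMap_apply_toNNReal {T : ℝ≥0} (hT : T ≤ β) :
    ContinuousOn (fun r : ℝ ↦ starMap A (γ r.toNNReal)) (Icc 0 T) := by
  have hpath : Continuous fun r : ℝ ↦ γ r.toNNReal := hγ.continuous.comp continuous_real_toNNReal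
  refine (continuousOn_starMap hA).comp hpath.continuousOn fun r hr ↦ ⟨hγ.im_nonneg _, hnotA _ ?_⟩
  rw [← NNReal.coe_le_coe, Real.coe_toNNReal _ hr.1]
  exact hr.2.trans (NNReal.coe_le_coe.2 hT)

/-- **The class of `E_A ∘ γ` stopped at `T ≤ β₂` is the class of the image curve stopped at `σ T`**
(two monotone traversals `s ↦ T s` and `s ↦ τ(σ(T) s)` of the same arc). [cite: LawlerSchrammWerner2003Restriction, §5] -/
theorem thr_stoppedPathClass_starMap_eq_stopClass (γc : C(ℝ≥0, ℂ)) (hγc : ∀ t, γc t = γ' t) {T : ℝ≥0}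
    (hT : T ≤ β₂) : stoppedPathClass (starMap A) γ T = stopClass γc (thrClockC W A T) := by
  have hTβ : T ≤ β := hT.trans hβ₂
  have hTI : (T : ℝ) ∈ Icc (0 : ℝ) β := ⟨T.coe_nonneg, NNReal.coe_le_coe.2 hTβ⟩
  set σT : ℝ := thrClock W A T with hσT
  have hσβ : σT ≤ thrClock W A β :=
    (strictMonoOn_thrClock hint).monotoneOn hTI ⟨β.coe_nonneg, le_rfl⟩ (NNReal.coe_le_coe.2 hTβ)
  have hσT0 : 0 ≤ σT := (thrClock_mem hint hTI).1
  have hσTcoe : ((thrClockC W A T : ℝ≥0) : ℝ) = σT := coe_thrClockC hint hTβ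
  rw [stoppedPathClass_eq (thr_continuous_starMap_stoppedPath hA hγ hnotA hTβ), stopClass,
    CurveClass.mk_eq_mk]
  set q : ℝ → ℝ := fun r ↦ max 0 (min 1 r) with hq
  have hq01 : ∀ r, q r ∈ Icc (0 : ℝ) 1 := fun r ↦ ⟨le_max_left _ _, max_le zero_le_one (min_le_left _ _)⟩
  set h₁ : ℝ → ℝ := fun r ↦ (T : ℝ) * q r with hh₁
  set h₂ : ℝ → ℝ := fun r ↦ thrClockInv W A β (σT * q r) with hh₂
  have hmemσ : ∀ r, σT * q r ∈ Icc (0 : ℝ) (thrClock W A β) := fun r ↦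
    ⟨mul_nonneg hσT0 (hq01 r).1, (mul_le_of_le_one_right hσT0 (hq01 r).2).trans hσβ⟩
  have hcontInv := continuousOn_thrClockInv hint
  have hmonoInv := (strictMonoOn_thrClockInv hint).monotoneOn
  refine Curve.reparamDist_eq_zero_of_monotone' (m := (T : ℝ)) T.coe_nonneg
    (V := fun r ↦ starMap A (γ r.toNNReal)) ?_ (h₁ := h₁) (h₂ := h₂) ?_ ?_ ?_ ?_ ?_ ?_ ?_ ?_ ?_ ?_
  · exact thr_continuousOn_starMap_apply_toNNReal hA hγ hnotA hTβ
  · exact continuous_const.mul continuous_clampUnit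
  · exact hcontInv.comp_continuous (continuous_const.mul continuous_clampUnit) hmemσ
  · exact fun r r' hrr' ↦ mul_le_mul_of_nonneg_left (monotone_clampUnit hrr') T.coe_nonneg
  · exact fun r r' hrr' ↦ hmonoInv (hmemσ r) (hmemσ r')
      (mul_le_mul_of_nonneg_left (monotone_clampUnit hrr') hσT0)
  · simp [hh₁, hq]
  · simp only [hh₂, hq]
    rw [min_eq_right zero_le_one, max_self, mul_zero]
    exact thrClockInv_zero hint
  · simp only [hh₁, hq]
    rw [min_self, max_eq_right zero_le_one, mul_one]
  · simp only [hh₂, hq]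
    rw [min_self, max_eq_right zero_le_one, mul_one, hσT]
    exact thrClockInv_thrClock hint hTI
  · intro t
    show starMap A (γ (((T : ℝ) * t).toNNReal)) = starMap A (γ (h₁ t).toNNReal)
    simp only [hh₁, hq, clampUnit_of_mem t]
  · intro t
    show γc (((thrClockC W A T : ℝ) * t).toNNReal) = starMap A (γ (h₂ t).toNNReal)
    simp only [hh₂, hq, clampUnit_of_mem t, hσTcoe]
    have hr := hmemσ t
    simp only [hq, clampUnit_of_mem t] at hr
    obtain ⟨hτI, hστ⟩ := thrClockInv_spec hint hr
    have hle : (thrClockInv W A β (σT * t)).toNNReal ≤ T := by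
      rw [← NNReal.coe_le_coe, Real.coe_toNNReal _ hτI.1]
      have h2 : σT ∈ Icc (0 : ℝ) (thrClock W A β) := ⟨hσT0, hσβ⟩
      have := hmonoInv hr h2 (mul_le_of_le_one_right hσT0 t.2.2)
      rwa [hσT, thrClockInv_thrClock hint hTI] at this
    have hσu : thrClockC W A (thrClockInv W A β (σT * t)).toNNReal = (σT * t).toNNReal := by
      have hle' : (thrClockInv W A β (σT * t)).toNNReal ≤ β := hle.trans hTβ
      apply NNReal.eq
      rw [coe_thrClockC hint hle', Real.coe_toNNReal _ hτI.1, hστ, Real.coe_toNNReal _ hr.1]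
    rw [← hσu, hγc, htip _ (hle.trans hT)]

omit hA in
/-- **Dictionary of first hits, through swallows.** If `z ∈ S' ↔ E_A z ∈ S` off `A` on the closed
half-plane and `γ` first hits the closed set `S'` at `t ≤ β₂`, then the image curve first hits the
closed set `S` at `σ t`. [cite: LawlerSchrammWerner2003Restriction, §5] -/
theorem thr_firstHit_imageTrace_eq (hγ' : Continuous γ') {S S' : Set ℂ} (hS : IsClosed S)
    (hS' : IsClosed S') (hdict : ∀ z : ℂ, 0 ≤ z.im → z ∉ A → (z ∈ S' ↔ starMap A z ∈ S)) {t : ℝ≥0}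
    (ht : firstHit γ S' = t) (htβ : t ≤ β₂) : firstHit γ' S = thrClockC W A t := by
  have him := hγ.im_nonneg
  have htβ' : t ≤ β := htβ.trans hβ₂
  obtain ⟨t₀, ht₀, hγt⟩ := exists_firstHit_eq_coe hγ.continuous hS' (by rw [ht]; exact WithTop.coe_ne_top)
  obtain rfl : t₀ = t := WithTop.coe_injective (ht₀.symm.trans ht)
  have hmem : γ' (thrClockC W A t₀) ∈ S := by
    rw [htip t₀ htβ]; exact (hdict _ (him t₀) (hnotA t₀ htβ')).1 hγt
  refine le_antisymm (firstHit_le hmem) ?_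
  by_contra hlt
  push Not at hlt
  obtain ⟨q, hq, hγ'q⟩ := exists_firstHit_eq_coe hγ' hS (ne_top_of_lt hlt)
  rw [hq] at hlt
  have hqlt : q < thrClockC W A t₀ := WithTop.coe_lt_coe.1 hlt
  have hσt : ((thrClockC W A t₀ : ℝ≥0) : ℝ) = thrClock W A t₀ := coe_thrClockC hint htβ'
  have htI : (t₀ : ℝ) ∈ Icc (0 : ℝ) β := ⟨t₀.coe_nonneg, NNReal.coe_le_coe.2 htβ'⟩
  have hσβ : thrClock W A t₀ ≤ thrClock W A β :=
    (strictMonoOn_thrClock hint).monotoneOn htI ⟨β.coe_nonneg, le_rfl⟩ (NNReal.coe_le_coe.2 htβ')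
  have hqI : (q : ℝ) ∈ Icc (0 : ℝ) (thrClock W A β) :=
    ⟨q.coe_nonneg, ((NNReal.coe_le_coe.2 hqlt.le).trans_eq hσt).trans hσβ⟩
  set u : ℝ≥0 := (thrClockInv W A β q).toNNReal with hudef
  obtain ⟨huI, -⟩ := thrClockInv_spec hint hqI
  have huβ : u ≤ β := by
    rw [hudef, ← NNReal.coe_le_coe, Real.coe_toNNReal _ huI.1]; exact huI.2
  have hσu : thrClockC W A u = q := by
    rw [hudef]; exact thrClockC_toNNReal_thrClockInv hint (by
      rw [← NNReal.coe_le_coe, coe_thrClockC hint le_rfl]; exact hqI.2)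
  have hut : u < t₀ := by
    by_contra hle
    push Not at hle
    have h1 := thrClockC_mono hint hle huβ
    rw [hσu] at h1
    exact absurd hqlt (not_lt.2 h1)
  have hγ'q' : γ' q = starMap A (γ u) := by rw [← hσu]; exact htip u (hut.le.trans htβ)
  have hnotS' : γ u ∉ S' := notMem_of_lt_firstHit (by rw [ht]; exact_mod_cast hut)
  rw [hγ'q'] at hγ'q
  exact hnotS' ((hdict _ (him u) (hnotA u (hut.le.trans htβ'))).2 hγ'q)

end Thr

end Loewner

end Literature.Probability.RandomPlanarGeometry

end
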